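import Mathlib.Algebra.MvPolynomial.Equiv
import Mathlib.Algebra.MvPolynomial.CommRing
import Mathlib.RingTheory.Ideal.Quotient.Operations
import Mathlib.RingTheory.Ideal.Maps
import Mathlib.Logic.Equiv.Fin.Basic
import Mathlib.Algebra.BigOperators.Fin
import HarnessLib

/-!
# Fedder's test along a coordinate subspace: closed points and coefficient extraction through a slicing `S ≃ B[Y]`
# (crux `FInjectiveMacaulayfication`, line `graded-engine` §16, calibration G6c — generic infrastructure)

Support file for crux stmt-ResolutionOfSingularities-15315 (`FrobeniusLadder.FInjectiveMacaulayfication`), chain w45a,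
seat res-L1-w45a-stub-3. [OURS · L1 W4.5a, CRUX-PLAN v3 §C] — NOT a statement of the manuscript; AI-written, weaker than
expert review.

Fedder's criterion at an ARBITRARY closed point (`FedderAtMaximalIdeal.stub_fedderAtMaximalIdeal`: the clause holds at a
maximal ideal `Q` of `k[X]/(g)` as soon as `g^(p-1) ∉ (a₁^p, …, a_M^p)` for generators `aᵢ` of `P = Q ∩ k[X]`) needs, when
the hypersurface is singular along a whole coordinate SUBSPACE `V(Y₁, …, Y_r)` (a line in `FedderAlongCoordinateLine`; for
tri-2's threefold point `h` a PLANE and a LINE), two things at every closed point `P ⊇ (Y₁, …, Y_r)` at once: generators of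
`P`, and a way to read the test off ONE coefficient. Both are organised here through a SLICING — a ring isomorphism
`Ψ : S ≃+* B[Y_τ]` (`S` the ambient polynomial ring, `B` the polynomial ring of the base variables, `Y_s = Ψ⁻¹(X_s)` the
slice variables, `ι = Ψ⁻¹ ∘ C : B → S` the base embedding, `π = constantCoeff ∘ Ψ` the projection):

* `sub_C_constantCoeff_mem_span_X`, `sub_mem_span_slice` — `f - ι(π f)` lies in the ideal of the slice variables;
* `comap_slice_isMaximal`, `eq_span_slice_sup`, `eq_span_sliceFamily` — STRUCTURE of the closed points of the subspace:
  for `P` maximal containing the slice variables, `𝔭 = ι⁻¹ P` is maximal in `B`, `P = (Y_s) + 𝔭 S`, and with generators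
  `a₁, …, a_m` of `𝔭` the family `(Y_s)_s, (ι a_j)_j` (indexed by `Fin (r + m)` through `finSumFinEquiv`) generates `P`;
* `coeff_mem_span_of_mem_span` — COEFFICIENT EXTRACTION: if `f ∈ (Y_s^N, ι(a_j)^N)` and the exponent vector `d` has all
  entries `< N`, then the `Y^d`-coefficient of `Ψ f` lies in `(a_j^N) ⊆ B` (multiples of `Y_s^N` have no `Y^d`-term; `C (a_j^N)`
  passes through `coeff`).

So `g^(p-1) ∈ P^[p]` forces `coeff_d (Ψ g^(p-1)) ∈ 𝔭^[p]`, and a single visible coefficient decides Fedder's test uniformly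
along the subspace. All proofs are glue on Mathlib; no definitions. [folklore]
-/

-- single-problem summit: the doubled namespace component is forced
set_option linter.dupNamespace false

noncomputable section

namespace Summit.ResolutionOfSingularities.ResolutionOfSingularities.Theorems.FInjectiveMacaulayfication.CoordinateSlicing

open MvPolynomial

variable {S B : Type*} [CommRing S] [CommRing B] {τ : Type*}

/-! ## The slice decomposition `f = (f - ι π f) + ι π f` -/

/-- In `B[Y_τ]`, `F - C (constantCoeff F)` lies in the ideal generated by the variables. [folklore] -/
theorem sub_C_constantCoeff_mem_span_X (F : MvPolynomial τ B) :
    F - C (constantCoeff F) ∈ Ideal.span (Set.range (X : τ → MvPolynomial τ B)) := by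
  induction F using MvPolynomial.induction_on with
  | C a =>
    rw [constantCoeff_C, sub_self]
    exact Ideal.zero_mem _
  | add p q hp hq =>
    have e : p + q - C (constantCoeff (p + q)) = (p - C (constantCoeff p)) + (q - C (constantCoeff q)) := by
      simp only [map_add]
      ring
    rw [e]
    exact Ideal.add_mem _ hp hq
  | mul_X p n _ =>
    rw [map_mul, constantCoeff_X, mul_zero, map_zero, sub_zero]
    exact Ideal.mul_mem_left _ _ (Ideal.subset_span (Set.mem_range_self n))

/-- **Slice decomposition**: for a slicing `Ψ : S ≃+* B[Y_τ]`, every `f ∈ S` differs from `ι(π f) = Ψ⁻¹(C(constantCoeff (Ψ f)))`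
by an element of the ideal of the slice variables `Y_s = Ψ⁻¹(X_s)`. [folklore] -/
theorem sub_mem_span_slice (Ψ : S ≃+* MvPolynomial τ B) (f : S) :
    f - Ψ.symm (C (constantCoeff (Ψ f))) ∈ Ideal.span (Set.range fun s : τ => Ψ.symm (X s)) := by
  have h1 : f - Ψ.symm (C (constantCoeff (Ψ f))) = Ψ.symm (Ψ f - C (constantCoeff (Ψ f))) := by
    rw [map_sub, RingEquiv.symm_apply_apply]
  have h2 : (Set.range fun s : τ => Ψ.symm (X s)) = Ψ.symm '' Set.range (X : τ → MvPolynomial τ B) := by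
    rw [← Set.range_comp]
    rfl
  rw [h1, h2, ← Ideal.map_span]
  exact Ideal.mem_map_of_mem _ (sub_C_constantCoeff_mem_span_X (Ψ f))

/-! ## Structure of the closed points of a coordinate subspace -/

/-- **The base of a closed point of the subspace is a closed point**: if a maximal ideal `P` of `S` contains every slice
variable, then `𝔭 = ι⁻¹ P` (`ι = Ψ⁻¹ ∘ C`) is a maximal ideal of `B` — `B → S/P` is surjective by the slice decomposition,
and its kernel is `𝔭`. [folklore] -/
theorem comap_slice_isMaximal (Ψ : S ≃+* MvPolynomial τ B) (P : Ideal S) [P.IsMaximal]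
    (hy : ∀ s : τ, Ψ.symm (X s) ∈ P) :
    (P.comap (Ψ.symm.toRingHom.comp C)).IsMaximal := by
  letI := Ideal.Quotient.field P
  have hle : Ideal.span (Set.range fun s : τ => Ψ.symm (X s)) ≤ P :=
    Ideal.span_le.mpr (Set.range_subset_iff.mpr hy)
  have hsurj : Function.Surjective ((Ideal.Quotient.mk P).comp (Ψ.symm.toRingHom.comp C)) := by
    intro x
    obtain ⟨f, rfl⟩ := Ideal.Quotient.mk_surjective x
    refine ⟨constantCoeff (Ψ f), ?_⟩
    change Ideal.Quotient.mk P (Ψ.symm (C (constantCoeff (Ψ f)))) = Ideal.Quotient.mk P f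
    rw [Ideal.Quotient.eq]
    have hmem := P.neg_mem (hle (sub_mem_span_slice Ψ f))
    rwa [neg_sub] at hmem
  have hker : RingHom.ker ((Ideal.Quotient.mk P).comp (Ψ.symm.toRingHom.comp C)) =
      P.comap (Ψ.symm.toRingHom.comp C) := by
    ext b
    rw [RingHom.mem_ker, Ideal.mem_comap, RingHom.comp_apply, Ideal.Quotient.eq_zero_iff_mem]
  rw [← hker]
  exact RingHom.ker_isMaximal_of_surjective _ hsurj

/-- **`P = (Y_s) + 𝔭 S`** for a maximal (indeed any) ideal `P` containing the slice variables, `𝔭 = ι⁻¹ P`. [folklore] -/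
theorem eq_span_slice_sup (Ψ : S ≃+* MvPolynomial τ B) (P : Ideal S) (hy : ∀ s : τ, Ψ.symm (X s) ∈ P) :
    P = Ideal.span (Set.range fun s : τ => Ψ.symm (X s)) ⊔
      (P.comap (Ψ.symm.toRingHom.comp C)).map (Ψ.symm.toRingHom.comp C) := by
  have hle : Ideal.span (Set.range fun s : τ => Ψ.symm (X s)) ≤ P :=
    Ideal.span_le.mpr (Set.range_subset_iff.mpr hy)
  refine le_antisymm ?_ (sup_le hle Ideal.map_comap_le)
  intro f hf
  have h1 := sub_mem_span_slice Ψ f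
  have h2 : Ψ.symm (C (constantCoeff (Ψ f))) ∈ P := by
    have h3 := P.sub_mem hf (hle h1)
    rwa [sub_sub_cancel] at h3
  have h4 : constantCoeff (Ψ f) ∈ P.comap (Ψ.symm.toRingHom.comp C) := by
    rw [Ideal.mem_comap]
    exact h2
  rw [← sub_add_cancel f (Ψ.symm (C (constantCoeff (Ψ f))))]
  exact Submodule.add_mem_sup h1 (Ideal.mem_map_of_mem (Ψ.symm.toRingHom.comp C) h4)

/-- **Generators of a closed point of the subspace**: with generators `a₁, …, a_m` of `𝔭 = ι⁻¹ P`, the family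
`(Y_1, …, Y_r, ι a₁, …, ι a_m) : Fin (r + m) → S` generates `P`. [folklore] -/
theorem eq_span_sliceFamily {r m : ℕ} (Ψ : S ≃+* MvPolynomial (Fin r) B) (P : Ideal S)
    (hy : ∀ s : Fin r, Ψ.symm (X s) ∈ P) (a : Fin m → B)
    (ha : Ideal.span (Set.range a) = P.comap (Ψ.symm.toRingHom.comp C)) :
    P = Ideal.span (Set.range (Sum.elim (fun s : Fin r => Ψ.symm (X s)) (fun j : Fin m => Ψ.symm (C (a j))) ∘
      finSumFinEquiv.symm)) := by
  rw [finSumFinEquiv.symm.surjective.range_comp, Set.Sum.elim_range, Ideal.span_union,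
    eq_span_slice_sup Ψ P hy, ← ha, Ideal.map_span, ← Set.range_comp]
  rfl

/-! ## Coefficient extraction -/

/-- The `N`-th powers of the generating family, as a `Sum.elim`. [folklore] -/
theorem pow_sliceFamily_eq {r m : ℕ} (Ψ : S ≃+* MvPolynomial (Fin r) B) (a : Fin m → B) (N : ℕ) :
    (fun i : Fin (r + m) => (Sum.elim (fun s : Fin r => Ψ.symm (X s)) (fun j : Fin m => Ψ.symm (C (a j))) ∘
        finSumFinEquiv.symm) i ^ N) =
      Sum.elim (fun s : Fin r => Ψ.symm (X s) ^ N) (fun j : Fin m => Ψ.symm (C (a j)) ^ N) ∘ finSumFinEquiv.symm := by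
  funext i
  simp only [Function.comp_apply]
  rcases finSumFinEquiv.symm i with s | j <;> rfl

/-- **COEFFICIENT EXTRACTION.** For a slicing `Ψ : S ≃+* B[Y_1, …, Y_r]`, base elements `a₁, …, a_m ∈ B`, and an exponent
vector `d` with all `d_s < N`: if `f ∈ (Y_s^N, ι(a_j)^N)` then the `Y^d`-coefficient of `Ψ f` lies in `(a_j^N) ⊆ B` — a multiple
of `Y_s^N` has no `Y^d`-term (`d_s < N`), and `coeff_d (C(a_j^N) · G) = a_j^N · coeff_d G`. [folklore] -/
theorem coeff_mem_span_of_mem_span {r m : ℕ} (Ψ : S ≃+* MvPolynomial (Fin r) B) (d : Fin r →₀ ℕ) (N : ℕ)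
    (hd : ∀ s, d s < N) (a : Fin m → B) {f : S}
    (hf : f ∈ Ideal.span (Set.range fun i : Fin (r + m) =>
      (Sum.elim (fun s : Fin r => Ψ.symm (X s)) (fun j : Fin m => Ψ.symm (C (a j))) ∘ finSumFinEquiv.symm) i ^ N)) :
    coeff d (Ψ f) ∈ Ideal.span (Set.range fun j : Fin m => a j ^ N) := by
  rw [pow_sliceFamily_eq, finSumFinEquiv.symm.surjective.range_comp, Set.Sum.elim_range, Ideal.span_union,
    Submodule.mem_sup] at hf
  obtain ⟨f₁, hf₁, f₂, hf₂, rfl⟩ := hf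
  rw [map_add, coeff_add]
  refine Ideal.add_mem _ ?_ ?_
  · -- slice part: the `Y^d`-coefficient of a multiple of `Y_s^N` vanishes
    obtain ⟨c, rfl⟩ := Ideal.mem_span_range_iff_exists_fun.mp hf₁
    rw [map_sum, coeff_sum]
    refine Submodule.sum_mem _ fun s _ => ?_
    rw [map_mul, map_pow, RingEquiv.apply_symm_apply, X_pow_eq_monomial, coeff_mul_monomial', if_neg]
    · exact Ideal.zero_mem _
    · rw [Finsupp.single_le_iff]
      exact not_le.mpr (hd s)
  · -- base part: `C (a_j^N)` passes through the coefficient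
    obtain ⟨c, rfl⟩ := Ideal.mem_span_range_iff_exists_fun.mp hf₂
    rw [map_sum, coeff_sum]
    refine Submodule.sum_mem _ fun j _ => ?_
    rw [map_mul, map_pow, RingEquiv.apply_symm_apply, ← map_pow, mul_comm, coeff_C_mul]
    exact Ideal.mul_mem_right _ _ (Ideal.subset_span (Set.mem_range_self j))

end Summit.ResolutionOfSingularities.ResolutionOfSingularities.Theorems.FInjectiveMacaulayfication.CoordinateSlicing

end
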